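import Mathlib
import Literature.Analysis.FunctionSpaces.TorusFluidGlueProofs
import Literature.Analysis.FunctionSpaces.TorusLinearisedFormTruncation
import Literature.Analysis.FluidPDE.CheskidovAssemblyTools
import HarnessLib

/-!
# The absorbing energy ball of forced Navier–Stokes on the torus (instab g10, cell `ns-blowup`, 2026-08-26)

HONEST FRAMING (human ruling D-0035): nothing here is a claim about Navier–Stokes blow-up.
WHAT THIS IS NOT: not NS blow-up evidence. Kernel form of the elementary energy bound behind
`instab/INSTAB-BRIDGE.md` §13 l.121 (b) («why the parabolic ‹instability ⇒ blow-up› dichotomy has no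
Navier–Stokes form: the energy is ABSORBING»): for a classical solution `(u, p)` of the forced
Navier–Stokes system `∂ₜu + (u·∇)u = νΔu − ∇p + f` on the unit torus `T^d = ℝ^d/ℤ^d` with mean-zero
velocity slices, the energy balance `dE/dt = −ν‖∇u‖₂² + ∫⟪f, u⟫`
(`Torus.IsClassicalNSSolutionOn.energy_balance`), the Poincaré inequality `4π² ∫‖u‖² ≤ ‖∇u‖₂²`
(`Torus.four_pi_sq_mul_integral_norm_sq_le_gradNormSq`) and Cauchy–Schwarz give

* `le_max_of_deriv_neg_above` — the scalar fencing step (a continuous function with right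
  derivatives that are negative wherever the function exceeds `C` never exceeds `max (E a) C`;
  Mathlib's `image_le_of_deriv_right_lt_deriv_boundary` against the constant barriers `C' + ε`);
* `sqrt_integral_norm_sq_le_max` — on any `[a, b] ⊆ S` on which `‖f(t)‖_{L²} ≤ F`:
  `‖u(t)‖_{L²} ≤ max (‖u(a)‖_{L²}) (F / (4π²ν))` for all `t ∈ [a, b]` — the ball of radius
  `F/(4π²ν)` is ABSORBING and every larger ball is forward-invariant (Foias–Temam / Doering–Foias
  2002 §2 absorbing ball, classical-solution form);
* `sqrt_integral_norm_sq_le_max_of_early_bound` — the «ancient solution» form: if at arbitrarily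
  early times in `S` the `L²` norm does not exceed `R₀ + ε` (every `ε > 0`), then
  `‖u(t)‖_{L²} ≤ max R₀ (F/(4π²ν))` for EVERY `t ∈ S`. For the unstable-manifold orbit `𝓡` of a
  forced steady state `U` (`𝓡(t) → U` in `L²` as `t → −∞`, force `f = −νΔU`; `‖f‖_{L²} = 4π²ν‖U‖_{L²}`
  when `U` lives on the first Fourier shell, e.g. the ABC flow) this reads `‖𝓡(t)‖_{L²} ≤ ‖U‖_{L²}`
  for all `t`: the whole unstable manifold lies in the host's energy ball, so a loss of smoothness
  along it is invisible to the energy.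

Mathlib + Literature only; theorems only, no new definitions.
-/

noncomputable section

namespace Summit.NavierStokesRegularity.FluidComputer.ForcedEnergyBall

open Set Filter MeasureTheory Literature.Analysis.FunctionSpaces Literature.Analysis.FunctionSpaces.Torus
open scoped InnerProductSpace Topology

variable {d : Type*} [Fintype d] [DecidableEq d]

/-- **Scalar fencing step.** If `E` is continuous on `[a, b]`, has right derivative `E' t` at every
`t ∈ [a, b)`, and `E' t < 0` whenever `E t > C`, then `E t ≤ max (E a) C` on `[a, b]`. -/
theorem le_max_of_deriv_neg_above {E E' : ℝ → ℝ} {a b C : ℝ}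
    (hE : ContinuousOn E (Icc a b)) (hE' : ∀ t ∈ Ico a b, HasDerivWithinAt E (E' t) (Ici t) t)
    (hneg : ∀ t ∈ Ico a b, C < E t → E' t < 0) :
    ∀ t ∈ Icc a b, E t ≤ max (E a) C := by
  intro t ht
  refine le_of_forall_pos_le_add fun ε hε => ?_
  have hB : ∀ x, HasDerivAt (fun _ : ℝ => max (E a) C + ε) (0 : ℝ) x :=
    fun x => hasDerivAt_const x _
  exact image_le_of_deriv_right_lt_deriv_boundary hE hE' (B := fun _ => max (E a) C + ε)
    (B' := fun _ => 0) (by linarith [le_max_left (E a) C]) hB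
    (fun x hx hxB => by
      have hC : C < E x := by rw [hxB]; linarith [le_max_right (E a) C]
      exact hneg x hx hC) ht

/-- **The absorbing energy ball (classical forced Navier–Stokes on `T^d`).** Let `(u, p)` solve the
forced Navier–Stokes system classically on `S × T^d`, `S` convex, `ν > 0`, with mean-zero velocity
slices and `‖f(t)‖_{L²} ≤ F` on `[a, b] ⊆ S`. Then for every `t ∈ [a, b]`,
`‖u(t)‖_{L²} ≤ max (‖u(a)‖_{L²}) (F / (4π²ν))`. -/
theorem sqrt_integral_norm_sq_le_max {S : Set ℝ} {ν : ℝ}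
    {f u : ℝ → UnitAddTorus d → EuclideanSpace ℝ d} {p : ℝ → UnitAddTorus d → ℝ}
    (h : IsClassicalNSSolutionOn S ν f u p) (hS : Convex ℝ S) (hν : 0 < ν) {a b F : ℝ}
    (hab : Icc a b ⊆ S) (h0 : ∀ t ∈ Icc a b, HasZeroMean (u t))
    (hf : ∀ t ∈ Icc a b, IsSmooth (f t))
    (hF : ∀ t ∈ Icc a b, Real.sqrt (∫ x, ‖f t x‖ ^ 2) ≤ F) :
    ∀ t ∈ Icc a b, Real.sqrt (∫ x, ‖u t x‖ ^ 2) ≤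
      max (Real.sqrt (∫ x, ‖u a x‖ ^ 2)) (F / (4 * Real.pi ^ 2 * ν)) := by
  intro t ht
  have hane : a ∈ Icc a b := left_mem_Icc.2 (ht.1.trans ht.2)
  have hF0 : 0 ≤ F := (Real.sqrt_nonneg _).trans (hF a hane)
  have hπν : 0 < 4 * Real.pi ^ 2 * ν := by positivity
  set Rf : ℝ := F / (4 * Real.pi ^ 2 * ν) with hRf
  have hRf0 : 0 ≤ Rf := div_nonneg hF0 hπν.le
  -- the energy and its one-sided derivative from the energy balance
  set E : ℝ → ℝ := fun s => kineticEnergy (u s) with hEdef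
  set E' : ℝ → ℝ := fun s => -ν * gradNormSq (u s) + ∫ x, ⟪f s x, u s x⟫_ℝ with hE'def
  have hder : ∀ s ∈ S, HasDerivWithinAt E (E' s) S s := fun s hs =>
    IsClassicalNSSolutionOn.energy_balance_holds h hS hs
  have hcont : ContinuousOn E (Icc a b) := fun s hs =>
    ((hder s (hab hs)).continuousWithinAt).mono hab
  have hE' : ∀ s ∈ Ico a b, HasDerivWithinAt E (E' s) (Ici s) s := fun s hs =>
    (hder s (hab (Ico_subset_Icc_self hs))).mono_of_mem_nhdsWithin
      (mem_of_superset (Icc_mem_nhdsGE hs.2) ((Icc_subset_Icc_left hs.1).trans hab))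
  -- the derivative is negative as soon as the energy exceeds `Rf² / 2`
  have hneg : ∀ s ∈ Ico a b, Rf ^ 2 / 2 < E s → E' s < 0 := by
    intro s hs hC
    have hsI : s ∈ Icc a b := Ico_subset_Icc_self hs
    have hus : IsSmooth (u s) := h.smooth_velocity.isSmooth_slice (hab hsI)
    set L : ℝ := Real.sqrt (∫ x, ‖u s x‖ ^ 2) with hL
    have hI0 : 0 ≤ ∫ x, ‖u s x‖ ^ 2 := integral_nonneg fun _ => sq_nonneg _
    have hL2 : L ^ 2 = ∫ x, ‖u s x‖ ^ 2 := Real.sq_sqrt hI0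
    have hL0 : 0 ≤ L := Real.sqrt_nonneg _
    have hEs : E s = 2⁻¹ * L ^ 2 := by rw [hL2]; rfl
    -- `Rf < L`
    have hRL : Rf < L := by
      have h1 : Rf ^ 2 < L ^ 2 := by rw [hEs] at hC; linarith
      exact lt_of_pow_lt_pow_left₀ 2 hL0 h1
    have hLpos : 0 < L := lt_of_le_of_lt hRf0 hRL
    -- Poincaré and Cauchy–Schwarz
    have hP : 4 * Real.pi ^ 2 * L ^ 2 ≤ gradNormSq (u s) := by
      rw [hL2]; exact four_pi_sq_mul_integral_norm_sq_le_gradNormSq hus (h0 s hsI)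
    have hCS : ∫ x, ⟪f s x, u s x⟫_ℝ ≤ F * L := by
      have h1 := Literature.Analysis.FluidPDE.abs_integral_inner_le_sqrt_mul_sqrt
        ((hf s hsI).memLp 2) (hus.memLp 2)
      exact (le_abs_self _).trans (h1.trans (mul_le_mul_of_nonneg_right (hF s hsI) hL0))
    have hFL : F < 4 * Real.pi ^ 2 * ν * L := by
      rw [hRf, div_lt_iff₀ hπν] at hRL; linarith
    calc E' s = -ν * gradNormSq (u s) + ∫ x, ⟪f s x, u s x⟫_ℝ := rfl
      _ ≤ -ν * (4 * Real.pi ^ 2 * L ^ 2) + F * L := by nlinarith [hP, hCS, hν]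
      _ = L * (F - 4 * Real.pi ^ 2 * ν * L) := by ring
      _ < 0 := mul_neg_of_pos_of_neg hLpos (by linarith)
  -- fence
  have hfence := le_max_of_deriv_neg_above hcont hE' hneg t ht
  -- back to `L²` norms
  have hIt : 0 ≤ ∫ x, ‖u t x‖ ^ 2 := integral_nonneg fun _ => sq_nonneg _
  have hIa : 0 ≤ ∫ x, ‖u a x‖ ^ 2 := integral_nonneg fun _ => sq_nonneg _
  have hEt : E t = 2⁻¹ * ∫ x, ‖u t x‖ ^ 2 := rfl
  have hEa : E a = 2⁻¹ * ∫ x, ‖u a x‖ ^ 2 := rfl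
  rcases le_total (E a) (Rf ^ 2 / 2) with hcase | hcase
  · -- the absorbing ball wins
    have h1 : E t ≤ Rf ^ 2 / 2 := hfence.trans (by rw [max_eq_right hcase])
    have h2 : ∫ x, ‖u t x‖ ^ 2 ≤ Rf ^ 2 := by rw [hEt] at h1; linarith
    exact le_max_of_le_right ((Real.sqrt_le_sqrt h2).trans (by rw [Real.sqrt_sq hRf0]))
  · have h1 : E t ≤ E a := hfence.trans (by rw [max_eq_left hcase])
    have h2 : ∫ x, ‖u t x‖ ^ 2 ≤ ∫ x, ‖u a x‖ ^ 2 := by rw [hEt, hEa] at h1; linarith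
    exact le_max_of_le_left (Real.sqrt_le_sqrt h2)

/-- **Ancient-solution form of the absorbing ball.** Under the hypotheses of
`sqrt_integral_norm_sq_le_max` on the whole convex time set `S` (mean-zero slices, `‖f(t)‖_{L²} ≤ F`
on `S`), if at arbitrarily early times of `S` the velocity has `L²` norm at most `R₀ + ε` (every
`ε > 0`) — e.g. `u(t) → U` in `L²` as `t → −∞` with `‖U‖_{L²} = R₀` — then
`‖u(t)‖_{L²} ≤ max R₀ (F / (4π²ν))` for every `t ∈ S`. -/
theorem sqrt_integral_norm_sq_le_max_of_early_bound {S : Set ℝ} {ν : ℝ}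
    {f u : ℝ → UnitAddTorus d → EuclideanSpace ℝ d} {p : ℝ → UnitAddTorus d → ℝ}
    (h : IsClassicalNSSolutionOn S ν f u p) (hS : Convex ℝ S) (hν : 0 < ν) {F R₀ : ℝ}
    (h0 : ∀ t ∈ S, HasZeroMean (u t)) (hf : ∀ t ∈ S, IsSmooth (f t))
    (hF : ∀ t ∈ S, Real.sqrt (∫ x, ‖f t x‖ ^ 2) ≤ F)
    (hearly : ∀ ε : ℝ, 0 < ε → ∀ T : ℝ, ∃ a ∈ S, a ≤ T ∧ Real.sqrt (∫ x, ‖u a x‖ ^ 2) ≤ R₀ + ε) :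
    ∀ t ∈ S, Real.sqrt (∫ x, ‖u t x‖ ^ 2) ≤ max R₀ (F / (4 * Real.pi ^ 2 * ν)) := by
  intro t ht
  refine le_of_forall_pos_le_add fun ε hε => ?_
  obtain ⟨a, haS, hat, hua⟩ := hearly ε hε t
  have hsub : Icc a t ⊆ S := (convex_iff_ordConnected.mp hS).out haS ht
  have h1 := sqrt_integral_norm_sq_le_max h hS hν hsub (fun s hs => h0 s (hsub hs))
    (fun s hs => hf s (hsub hs)) (fun s hs => hF s (hsub hs)) t (right_mem_Icc.2 hat)
  calc Real.sqrt (∫ x, ‖u t x‖ ^ 2)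
      ≤ max (Real.sqrt (∫ x, ‖u a x‖ ^ 2)) (F / (4 * Real.pi ^ 2 * ν)) := h1
    _ ≤ max (R₀ + ε) (F / (4 * Real.pi ^ 2 * ν) + ε) :=
        max_le_max hua (le_add_of_nonneg_right hε.le)
    _ = max R₀ (F / (4 * Real.pi ^ 2 * ν)) + ε := max_add_add_right _ _ _

end Summit.NavierStokesRegularity.FluidComputer.ForcedEnergyBall
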